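import Literature.Probability.Percolation.ZdFourArmOutLanded
import Literature.Probability.Percolation.KSTPeriodicArmDualityPlanar
import HarnessLib

/-!
# The outer-landed four-arm event of bond percolation on `ℤ²` is a four-arm event (a discrete Jordan lemma)

Topic `Literature/Probability/Percolation`; critical bond percolation on `ℤ²`. PROOFS ONLY (no
definition, no named fact).

A brick of Kesten's arm-separation theorem for four alternating arms (internal half, run on the
outer-landed event `zdFourArmOutLanded` of `ZdFourArmOutLanded.lean`; H. Kesten, CMP 109 (1987), §2
Lemma 5; P. Nolin, EJP 13 (2008), §4.4 [arXiv 0711.4948, p. 13]): the reading "two closed dual arms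
⟹ two distinct open annulus-clusters" of the arms ↔ clusters dictionary (Kesten 1982, §2.2–2.3;
Grimmett 1999, §11.2) for dual arms starting from ARBITRARY faces inside the inner square `B(m)` —
the layout of `zdFourArmOutLanded`, whose inner extremities are free — as opposed to the fixed
starting faces of `sqAnnulus_dualArmsTB_false` (`SqAnnulusDualBarrier.lean`, the layout of the
well-separated event).

* `exists_dart_sepEdge_mem_edges_lr_box` — Bollobás–Riordan's Lemma 1 of Ch. 3 in a general box
  `[L, R] × [B, T]`: a left–right lattice walk of the box and a top–bottom walk of faces of
  `[L, R-1] × [B-1, T]` cross (translation of `exists_dart_sepEdge_mem_edges`).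
* `exists_faceWalk_insideBox` — two faces inside `B(m)` are joined by a walk of faces inside `B(m)`;
  `exists_mem_sepEdge_mem_box_pred_of_insideBox` — a step between faces inside `B(m)` crosses an
  edge with an endpoint in the hole `B(m-1)`.
* `sqAnnulus_outDualArms_cross` — **the combinatorial barrier**: a lattice walk `W` of
  `A_{m,N}` from the column `-N` to the column `N`, a walk of faces from a face inside `B(m)` to the
  face row `N` and a walk of faces from a face inside `B(m)` to the face row `-N-1`, both crossing
  only edges with both endpoints in `A_{m,N}`, cannot avoid each other: some edge crossed by one of
  the two face walks is an edge of `W`.  Proof: extend `W` by one step at each end to a left–right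
  crossing of `[-N-1, N+1] × [-N, N]`, join the two face walks through faces inside `B(m)` (whose
  steps cross only edges meeting the hole, hence no edge of `W`) into one top–bottom walk of faces,
  and apply `exists_dart_sepEdge_mem_edges_lr_box`.
* `not_openConnIn_sqAnnulus_of_outDualArms` — percolation form; whence
  **`mem_fourArmTwoClusters_of_mem_zdFourArmOutLanded`** (`zdFourArmOutLanded m N ⊆
  fourArmTwoClusters m N` on lattice configurations, `1 ≤ m ≤ N`),
  `real_zdFourArmOutLanded_le_fourArmTwoClusters`, and the vertex-disjointness of the two open
  bodies `disjoint_support_of_mem_zdFourArmOutLanded` used by the inner surgery.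

## References

* H. Kesten, *Percolation theory for mathematicians* (1982), §2.2–2.3 [KestenPTM1982].
* B. Bollobás, O. Riordan, *Percolation* (2006), Ch. 3, Lemma 1 [BollobasRiordan2006].
* P. Nolin, *Near-critical percolation in two dimensions*, EJP 13 (2008), §4.1 (arm events and
  clusters), §4.4 [Nolin2008].
-/

noncomputable section

open Set SimpleGraph

namespace Literature.Probability.Percolation

open LatticeModels KSTPeriodic

/-! ### Bollobás–Riordan's crossing lemma in a general box, left–right form -/

/-- **A left–right walk of a box and a top–bottom face walk of its horizontal dual cross**
(`exists_dart_sepEdge_mem_edges` translated to the box `[L, R] × [B, T]`): if `P` is a lattice walk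
inside the box from its left column to its right column and `Q` a walk of faces (lower-left corners)
inside `[L, R-1] × [B-1, T]` from the face row `T` to the face row `B-1`, some dart of `Q` crosses an
edge of `P`. [cite: BollobasRiordan2006, Ch. 3, Lemma 1] -/
theorem exists_dart_sepEdge_mem_edges_lr_box {L R B T : ℤ} {a b t s : Site 2}
    (P : (zdGraph 2).Walk a b) (Q : (zdGraph 2).Walk t s)
    (hP : ∀ z ∈ P.support, L ≤ z 0 ∧ z 0 ≤ R ∧ B ≤ z 1 ∧ z 1 ≤ T)
    (hQ : ∀ z ∈ Q.support, L ≤ z 0 ∧ z 0 + 1 ≤ R ∧ B - 1 ≤ z 1 ∧ z 1 ≤ T)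
    (ha : a 0 = L) (hb : b 0 = R) (ht : t 1 = T) (hs : s 1 = B - 1) :
    ∃ dq ∈ Q.darts, sepEdge dq.fst dq.snd ∈ P.edges := by
  classical
  have haR := hP a P.start_mem_support
  obtain ⟨M, hM⟩ : ∃ M : ℕ, (M : ℤ) = R - L := ⟨(R - L).toNat, Int.toNat_of_nonneg (by omega)⟩
  obtain ⟨N, hN⟩ : ∃ N : ℕ, (N : ℤ) = T - B := ⟨(T - B).toNat, Int.toNat_of_nonneg (by omega)⟩
  set v : Site 2 := ![-L, -B] with hv
  have hv0 : v 0 = -L := rfl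
  have hv1 : v 1 = -B := rfl
  set φ := (zdShiftIso v).toEmbedding.toHom with hφ
  have hφapply : ∀ x : Site 2, φ x = x + v := fun x => rfl
  obtain ⟨dq', hdq', hsep⟩ := exists_dart_sepEdge_mem_edges (M := M) (N := N) (P.map φ) (Q.map φ)
    (fun z hz => by
      rw [Walk.support_map, List.mem_map] at hz
      obtain ⟨w, hw, rfl⟩ := hz
      have := hP w hw
      simp only [hφapply, Pi.add_apply, hv0, hv1]
      omega)
    (fun z hz => by
      rw [Walk.support_map, List.mem_map] at hz
      obtain ⟨w, hw, rfl⟩ := hz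
      have := hQ w hw
      simp only [hφapply, Pi.add_apply, hv0, hv1]
      omega)
    (by show (a + v) 0 = 0; rw [Pi.add_apply, hv0, ha]; ring)
    (by show (b + v) 0 = (M : ℤ); rw [Pi.add_apply, hv0, hb, hM]; ring)
    (by show (t + v) 1 = (N : ℤ); rw [Pi.add_apply, hv1, ht, hN]; ring)
    (by show (s + v) 1 = -1; rw [Pi.add_apply, hv1, hs]; ring)
  rw [Walk.darts_map, List.mem_map] at hdq'
  obtain ⟨dq, hdq, rfl⟩ := hdq'
  refine ⟨dq, hdq, ?_⟩
  have hsep' : Sym2.map (· + v) (sepEdge dq.fst dq.snd) ∈ (P.map φ).edges := by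
    rw [← sepEdge_add_right]; exact hsep
  rw [Walk.edges_map, List.mem_map] at hsep'
  obtain ⟨e, he, hee⟩ := hsep'
  have hinj : Function.Injective (Sym2.map (· + v : Site 2 → Site 2)) :=
    Sym2.map.injective (add_left_injective v)
  have : e = sepEdge dq.fst dq.snd := hinj (by rw [← hee]; rfl)
  exact this ▸ he

/-! ### Faces inside the inner square -/

section Inside

variable {m : ℕ}

/-- Both endpoints of the edge crossed by a step of faces `z → z'` are corners of the face `z`. [folklore] -/
theorem sepEdge_apply_mem_Icc_fst {z z' v : Site 2} (hadj : (zdGraph 2).Adj z z') (hv : v ∈ sepEdge z z') :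
    (z 0 ≤ v 0 ∧ v 0 ≤ z 0 + 1) ∧ (z 1 ≤ v 1 ∧ v 1 ≤ z 1 + 1) := by
  rw [sepEdge_comm] at hv
  exact sepEdge_apply_mem_Icc_snd hadj.symm hv

/-- A step between two faces inside `B(m)` (all corners in `B(m)`) crosses an edge one of whose
endpoints lies in the hole `B(m-1)` (`1 ≤ m`). [folklore] -/
theorem exists_mem_sepEdge_mem_box_pred_of_insideBox (hm : 1 ≤ m) {z z' : Site 2} (hadj : (zdGraph 2).Adj z z')
    (hz : -(m : ℤ) ≤ z 0 ∧ z 0 + 1 ≤ m ∧ -(m : ℤ) ≤ z 1 ∧ z 1 + 1 ≤ m)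
    (hz' : -(m : ℤ) ≤ z' 0 ∧ z' 0 + 1 ≤ m ∧ -(m : ℤ) ≤ z' 1 ∧ z' 1 + 1 ≤ m) :
    ∃ v ∈ sepEdge z z', v ∈ box 2 (m - 1) := by
  have key : ∀ v w : Site 2, sepEdge z z' = s(v, w) →
      ((z 0 ≤ v 0 ∧ v 0 ≤ z 0 + 1) ∧ (z 1 ≤ v 1 ∧ v 1 ≤ z 1 + 1)) →
      ((z' 0 ≤ v 0 ∧ v 0 ≤ z' 0 + 1) ∧ (z' 1 ≤ v 1 ∧ v 1 ≤ z' 1 + 1)) →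
      ((z 0 ≤ w 0 ∧ w 0 ≤ z 0 + 1) ∧ (z 1 ≤ w 1 ∧ w 1 ≤ z 1 + 1)) →
      ((z' 0 ≤ w 0 ∧ w 0 ≤ z' 0 + 1) ∧ (z' 1 ≤ w 1 ∧ w 1 ≤ z' 1 + 1)) →
      ∃ u ∈ sepEdge z z', u ∈ box 2 (m - 1) := by
    intro v w he hvz hvz' hwz hwz'
    rcases stepKind_of_adj hadj with ⟨h0, h1⟩ | ⟨h0, h1⟩ | ⟨h1, h0⟩ | ⟨h1, h0⟩
    all_goals
      by_cases hvb : v ∈ box 2 (m - 1)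
      · exact ⟨v, by rw [he]; exact Sym2.mem_mk_left _ _, hvb⟩
      · refine ⟨w, by rw [he]; exact Sym2.mem_mk_right _ _, ?_⟩
        rw [mem_box] at hvb ⊢
        rw [Fin.forall_fin_two] at hvb ⊢
        have hne : v ≠ w := by
          intro hvw
          have hvw' : sepEdge z z' ∈ (zdGraph 2).edgeSet := sepEdge_mem_edgeSet hadj
          rw [he, hvw] at hvw'
          exact ((zdGraph 2).mem_edgeSet.1 hvw').ne rfl
        have hadj' : (zdGraph 2).Adj v w := by
          have := sepEdge_mem_edgeSet hadj; rwa [he] at this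
        rcases stepKind_of_adj hadj' with ⟨e0, e1⟩ | ⟨e0, e1⟩ | ⟨e1, e0⟩ | ⟨e1, e0⟩ <;> omega
  exact key (sepLo z z') (sepHi z z') rfl (sepEdge_apply_mem_Icc_fst hadj (Sym2.mem_mk_left _ _))
    (sepEdge_apply_mem_Icc_snd hadj (Sym2.mem_mk_left _ _)) (sepEdge_apply_mem_Icc_fst hadj (Sym2.mem_mk_right _ _))
    (sepEdge_apply_mem_Icc_snd hadj (Sym2.mem_mk_right _ _))

/-- Both endpoints of the edge crossed by a step between faces inside `B(m)` lie in `B(m)`. [folklore] -/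
theorem mem_box_of_mem_sepEdge_of_insideBox {z z' v : Site 2} (hadj : (zdGraph 2).Adj z z')
    (hz : -(m : ℤ) ≤ z 0 ∧ z 0 + 1 ≤ m ∧ -(m : ℤ) ≤ z 1 ∧ z 1 + 1 ≤ m) (hv : v ∈ sepEdge z z') :
    v ∈ box 2 m := by
  obtain ⟨⟨h0, h0'⟩, ⟨h1, h1'⟩⟩ := sepEdge_apply_mem_Icc_fst hadj hv
  rw [mem_box, Fin.forall_fin_two]
  exact ⟨⟨by omega, by omega⟩, ⟨by omega, by omega⟩⟩

/-- A straight walk down a column. [folklore] -/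
theorem exists_walk_col {p q : Site 2} (h0 : p 0 = q 0) (h1 : q 1 ≤ p 1) :
    ∃ w : (zdGraph 2).Walk p q, ∀ z ∈ w.support, z 0 = q 0 ∧ q 1 ≤ z 1 ∧ z 1 ≤ p 1 := by
  obtain ⟨k, hk⟩ : ∃ k : ℕ, (k : ℤ) = p 1 - q 1 := ⟨(p 1 - q 1).toNat, Int.toNat_of_nonneg (by omega)⟩
  have hend : ((fun w : Site 2 => w - Pi.single 1 1)^[k] p) = q := by
    rw [Site.eq_iff_two, iterate_sub_single_apply_zero, iterate_sub_single_apply_one]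
    exact ⟨h0, by omega⟩
  refine ⟨(downRun p k).copy rfl hend, fun z hz => ?_⟩
  rw [Walk.support_copy, mem_support_downRun] at hz
  omega

/-- **Two faces inside `B(m)` are joined by a walk of faces inside `B(m)`** (along a row, then a
column). [folklore] -/
theorem exists_faceWalk_insideBox {f g : Site 2}
    (hf : -(m : ℤ) ≤ f 0 ∧ f 0 + 1 ≤ m ∧ -(m : ℤ) ≤ f 1 ∧ f 1 + 1 ≤ m)
    (hg : -(m : ℤ) ≤ g 0 ∧ g 0 + 1 ≤ m ∧ -(m : ℤ) ≤ g 1 ∧ g 1 + 1 ≤ m) :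
    ∃ C : (zdGraph 2).Walk f g, ∀ z ∈ C.support, -(m : ℤ) ≤ z 0 ∧ z 0 + 1 ≤ m ∧ -(m : ℤ) ≤ z 1 ∧ z 1 + 1 ≤ m := by
  -- corner face `k = (g₀, f₁)`
  set k : Site 2 := ![g 0, f 1] with hk
  have hk0 : k 0 = g 0 := rfl
  have hk1 : k 1 = f 1 := rfl
  -- row piece `f → k`
  obtain ⟨C₁, hC₁⟩ : ∃ C₁ : (zdGraph 2).Walk f k, ∀ z ∈ C₁.support,
      z 1 = f 1 ∧ min (f 0) (g 0) ≤ z 0 ∧ z 0 ≤ max (f 0) (g 0) := by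
    rcases le_total (g 0) (f 0) with hle | hle
    · obtain ⟨w, hw⟩ := exists_walk_row (p := f) (q := k) (by rw [hk1]) (by rw [hk0]; exact hle)
      refine ⟨w, fun z hz => ?_⟩
      have := hw z hz
      rw [hk0, hk1] at this
      exact ⟨this.1, le_trans (min_le_right _ _) this.2.1, le_trans this.2.2 (le_max_left _ _)⟩
    · obtain ⟨w, hw⟩ := exists_walk_row (p := k) (q := f) (by rw [hk1]) (by rw [hk0]; exact hle)
      refine ⟨w.reverse, fun z hz => ?_⟩
      rw [Walk.support_reverse, List.mem_reverse] at hz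
      have := hw z hz
      rw [hk0] at this
      exact ⟨this.1, le_trans (min_le_left _ _) this.2.1, le_trans this.2.2 (le_max_right _ _)⟩
  -- column piece `k → g`
  obtain ⟨C₂, hC₂⟩ : ∃ C₂ : (zdGraph 2).Walk k g, ∀ z ∈ C₂.support,
      z 0 = g 0 ∧ min (f 1) (g 1) ≤ z 1 ∧ z 1 ≤ max (f 1) (g 1) := by
    rcases le_total (g 1) (f 1) with hle | hle
    · obtain ⟨w, hw⟩ := exists_walk_col (p := k) (q := g) hk0 (by rw [hk1]; exact hle)
      refine ⟨w, fun z hz => ?_⟩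
      have := hw z hz
      rw [hk1] at this
      exact ⟨this.1, le_trans (min_le_right _ _) this.2.1, le_trans this.2.2 (le_max_left _ _)⟩
    · obtain ⟨w, hw⟩ := exists_walk_col (p := g) (q := k) hk0.symm (by rw [hk1]; exact hle)
      refine ⟨w.reverse, fun z hz => ?_⟩
      rw [Walk.support_reverse, List.mem_reverse] at hz
      have := hw z hz
      rw [hk0, hk1] at this
      exact ⟨this.1, le_trans (min_le_left _ _) this.2.1, le_trans this.2.2 (le_max_right _ _)⟩
  refine ⟨C₁.append C₂, fun z hz => ?_⟩
  rw [Walk.mem_support_append_iff] at hz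
  rcases hz with hz | hz
  · obtain ⟨e1, e0, e0'⟩ := hC₁ z hz
    have a1 := min_le_iff.1 e0
    have a2 := max_le_iff.2 (show f 0 ≤ (m : ℤ) - 1 ∧ g 0 ≤ (m : ℤ) - 1 from ⟨by omega, by omega⟩)
    have a3 := le_min (show -(m : ℤ) ≤ f 0 from hf.1) (show -(m : ℤ) ≤ g 0 from hg.1)
    refine ⟨le_trans a3 e0, by have := le_trans e0' a2; omega, by omega, by omega⟩
  · obtain ⟨e0, e1, e1'⟩ := hC₂ z hz
    have a2 := max_le_iff.2 (show f 1 ≤ (m : ℤ) - 1 ∧ g 1 ≤ (m : ℤ) - 1 from ⟨by omega, by omega⟩)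
    have a3 := le_min (show -(m : ℤ) ≤ f 1 from hf.2.2.1) (show -(m : ℤ) ≤ g 1 from hg.2.2.1)
    refine ⟨by omega, by omega, le_trans a3 e1, by have := le_trans e1' a2; omega⟩

end Inside

/-! ### The combinatorial barrier -/

section Barrier

variable {m N : ℕ}

/-- The faces of a walk of faces all of whose crossed edges have both endpoints in `B(N)`, started
from a face with lower-left corner in `[-N-1, N]²`, all have lower-left corner in `[-N-1, N]²`. [folklore] -/
theorem faceWalk_bounds_of_sepEdge_mem_box {f g : Site 2} (Q : (zdGraph 2).Walk f g)
    (hf : -(N : ℤ) - 1 ≤ f 0 ∧ f 0 ≤ N ∧ -(N : ℤ) - 1 ≤ f 1 ∧ f 1 ≤ N)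
    (hQ : ∀ d ∈ Q.darts, ∀ v ∈ sepEdge d.fst d.snd, v ∈ box 2 N) :
    ∀ z ∈ Q.support, -(N : ℤ) - 1 ≤ z 0 ∧ z 0 ≤ N ∧ -(N : ℤ) - 1 ≤ z 1 ∧ z 1 ≤ N := by
  intro z hz
  rw [← Walk.cons_map_snd_darts, List.mem_cons, List.mem_map] at hz
  rcases hz with rfl | ⟨d, hd, rfl⟩
  · exact hf
  · obtain ⟨⟨c0, c0'⟩, ⟨c1, c1'⟩⟩ := sepEdge_apply_mem_Icc_snd d.adj (Sym2.mem_mk_left _ _ : sepLo d.fst d.snd ∈ _)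
    have hb := hQ d hd (sepLo d.fst d.snd) (Sym2.mem_mk_left _ _)
    rw [mem_box, Fin.forall_fin_two] at hb
    omega

/-- **Dual arms from faces inside the inner square and a wall-to-wall walk of the annulus cross.**
For `1 ≤ m ≤ N`: a lattice walk `W` with all vertices in `A_{m,N}` from the column `-N` to the column
`N`, a walk of faces `QT` from a face inside `B(m)` to a face of the row `N`, and a walk of faces `QB`
from a face inside `B(m)` to a face of the row `-N-1`, both crossing only edges with both endpoints
in `A_{m,N}`: then some edge crossed by `QT` or by `QB` is an edge of `W`.
[cite: KestenPTM1982, §2.2–2.3 (planar duality on the square lattice)] [cite: BollobasRiordan2006, Ch. 3, Lemma 1] -/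
theorem sqAnnulus_outDualArms_cross (hm : 1 ≤ m) (hmN : m ≤ N)
    {a b : Site 2} (W : (zdGraph 2).Walk a b) (hW : ∀ v ∈ W.support, v ∈ sqAnnulus m N)
    (ha : a 0 = -(N : ℤ)) (hb : b 0 = N)
    {fT gT : Site 2} (QT : (zdGraph 2).Walk fT gT)
    (hfT : -(m : ℤ) ≤ fT 0 ∧ fT 0 + 1 ≤ m ∧ -(m : ℤ) ≤ fT 1 ∧ fT 1 + 1 ≤ m) (hgT : gT 1 = N)
    (hQTa : ∀ d ∈ QT.darts, ∀ v ∈ sepEdge d.fst d.snd, v ∈ sqAnnulus m N)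
    {fB gB : Site 2} (QB : (zdGraph 2).Walk fB gB)
    (hfB : -(m : ℤ) ≤ fB 0 ∧ fB 0 + 1 ≤ m ∧ -(m : ℤ) ≤ fB 1 ∧ fB 1 + 1 ≤ m) (hgB : gB 1 + 1 = -(N : ℤ))
    (hQBa : ∀ d ∈ QB.darts, ∀ v ∈ sepEdge d.fst d.snd, v ∈ sqAnnulus m N) :
    (∃ d ∈ QT.darts, sepEdge d.fst d.snd ∈ W.edges) ∨ ∃ d ∈ QB.darts, sepEdge d.fst d.snd ∈ W.edges := by
  classical
  -- coordinates of annulus sites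
  have hann : ∀ v : Site 2, v ∈ sqAnnulus m N → (-(N : ℤ) ≤ v 0 ∧ v 0 ≤ N ∧ -(N : ℤ) ≤ v 1 ∧ v 1 ≤ N) ∧
      v ∉ box 2 (m - 1) := by
    intro v hv
    have hv' := hv
    rw [mem_sqAnnulus_iff hm] at hv'
    simp only [sqAnnulus, Finset.mem_coe, mem_annulus] at hv
    exact ⟨⟨(hv'.1 0).1, (hv'.1 0).2, (hv'.1 1).1, (hv'.1 1).2⟩, hv.2⟩
  have hboxN : ∀ v : Site 2, v ∈ sqAnnulus m N → v ∈ box 2 N := by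
    intro v hv
    simp only [sqAnnulus, Finset.mem_coe, mem_annulus] at hv
    exact hv.1
  -- the extended left–right crossing `a - e₀ → a → … → b → b + e₀`
  set a' : Site 2 := a - Pi.single 0 1 with ha'
  set b' : Site 2 := b + Pi.single 0 1 with hb'
  have hadj_a : (zdGraph 2).Adj a' a := adj_of_stepKind (.right (by simp [ha']) (by simp [ha']))
  have hadj_b : (zdGraph 2).Adj b b' := adj_of_stepKind (.right (by simp [hb']) (by simp [hb']))
  set P : (zdGraph 2).Walk a' b' := (Walk.cons hadj_a W).concat hadj_b with hP
  have hPs : ∀ z ∈ P.support, -(N : ℤ) - 1 ≤ z 0 ∧ z 0 ≤ N + 1 ∧ -(N : ℤ) ≤ z 1 ∧ z 1 ≤ N := by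
    intro z hz
    rw [hP, Walk.support_concat, List.mem_append, List.mem_singleton, Walk.support_cons, List.mem_cons] at hz
    have haW := (hann a (hW a W.start_mem_support)).1
    have hbW := (hann b (hW b W.end_mem_support)).1
    rcases hz with (rfl | hz) | rfl
    · simp only [ha', Pi.sub_apply, single_zero_apply_zero, single_zero_apply_one, sub_zero]; omega
    · have := (hann z (hW z hz)).1; omega
    · simp only [hb', Pi.add_apply, single_zero_apply_zero, single_zero_apply_one, add_zero]; omega
  have hPe : ∀ e ∈ P.edges, e ∈ W.edges ∨ a' ∈ e ∨ b' ∈ e := by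
    intro e he
    rw [hP, Walk.edges_concat, List.concat_eq_append, List.mem_append, List.mem_singleton, Walk.edges_cons,
      List.mem_cons] at he
    rcases he with (rfl | he) | rfl
    · exact Or.inr (Or.inl (Sym2.mem_mk_left _ _))
    · exact Or.inl he
    · exact Or.inr (Or.inr (Sym2.mem_mk_right _ _))
  have ha'N : a' ∉ box 2 N := by
    intro h
    have := (mem_box.1 h 0).1
    simp only [ha', Pi.sub_apply, single_zero_apply_zero] at this
    omega
  have hb'N : b' ∉ box 2 N := by
    intro h
    have := (mem_box.1 h 0).2
    simp only [hb', Pi.add_apply, single_zero_apply_zero] at this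
    omega
  -- the connector through faces inside `B(m)` and the full top–bottom face walk
  obtain ⟨C, hC⟩ := exists_faceWalk_insideBox hfT hfB
  set Q : (zdGraph 2).Walk gT gB := QT.reverse.append (C.append QB) with hQ
  have hQTs := faceWalk_bounds_of_sepEdge_mem_box (N := N) QT ⟨by omega, by omega, by omega, by omega⟩
    (fun d hd v hv => hboxN v (hQTa d hd v hv))
  have hQBs := faceWalk_bounds_of_sepEdge_mem_box (N := N) QB ⟨by omega, by omega, by omega, by omega⟩
    (fun d hd v hv => hboxN v (hQBa d hd v hv))
  have hQs : ∀ z ∈ Q.support, -(N : ℤ) - 1 ≤ z 0 ∧ z 0 + 1 ≤ N + 1 ∧ -(N : ℤ) - 1 ≤ z 1 ∧ z 1 ≤ N := by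
    intro z hz
    rw [hQ, Walk.mem_support_append_iff, Walk.support_reverse, List.mem_reverse,
      Walk.mem_support_append_iff] at hz
    rcases hz with hz | hz | hz
    · have := hQTs z hz; omega
    · have := hC z hz; omega
    · have := hQBs z hz; omega
  obtain ⟨dq, hdq, hdqP⟩ := exists_dart_sepEdge_mem_edges_lr_box (L := -(N : ℤ) - 1) (R := (N : ℤ) + 1)
    (B := -(N : ℤ)) (T := (N : ℤ)) P Q hPs hQs
    (by simp only [ha', Pi.sub_apply, single_zero_apply_zero]; omega)
    (by simp only [hb', Pi.add_apply, single_zero_apply_zero]; omega) hgT (by omega)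
  -- the crossed edge is an edge of `W` (the two new edges have an endpoint off `B(N)`)
  rw [hQ, Walk.darts_append, List.mem_append, Walk.darts_reverse, List.mem_reverse, List.mem_map,
    Walk.darts_append, List.mem_append] at hdq
  rcases hdq with ⟨d, hd, rfl⟩ | hd | hd
  · -- a dart of `QT`, reversed
    have hsym : sepEdge d.symm.fst d.symm.snd = sepEdge d.fst d.snd := by
      rw [Dart.symm_toProd, Prod.fst_swap, Prod.snd_swap, sepEdge_comm]
    rw [hsym] at hdqP
    rcases hPe _ hdqP with h | h | h
    · exact Or.inl ⟨d, hd, h⟩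
    · exact absurd (hboxN _ (hQTa d hd _ h)) ha'N
    · exact absurd (hboxN _ (hQTa d hd _ h)) hb'N
  · -- a dart of the connector: its crossed edge meets the hole, edges of `P` do not
    exfalso
    obtain ⟨v, hv, hvb⟩ := exists_mem_sepEdge_mem_box_pred_of_insideBox hm dq.adj
      (hC _ (C.dart_fst_mem_support_of_mem_darts hd)) (hC _ (C.dart_snd_mem_support_of_mem_darts hd))
    rcases hPe _ hdqP with h | h | h
    · exact (hann v (hW v (forall_mem_support_of_mem_edges W h v hv))).2 hvb
    · exact ha'N (box_mono 2 (by omega) (mem_box_of_mem_sepEdge_of_insideBox dq.adj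
        (hC _ (C.dart_fst_mem_support_of_mem_darts hd)) h) |> fun h' => box_mono 2 hmN h')
    · exact hb'N (box_mono 2 (by omega) (mem_box_of_mem_sepEdge_of_insideBox dq.adj
        (hC _ (C.dart_fst_mem_support_of_mem_darts hd)) h) |> fun h' => box_mono 2 hmN h')
  · rcases hPe _ hdqP with h | h | h
    · exact Or.inr ⟨dq, hd, h⟩
    · exact absurd (hboxN _ (hQBa dq hd _ h)) ha'N
    · exact absurd (hboxN _ (hQBa dq hd _ h)) hb'N

/-- **Closed dual arms from faces inside the inner square separate the two open wall-to-wall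
half-arms** (percolation form): for a lattice configuration `ω` on `ℤ²` and `1 ≤ m ≤ N`, if there
are walks of faces from faces inside `B(m)` to the face rows `N` and `-N-1` crossing only
`ω`-closed edges with both endpoints in `A_{m,N}`, then no site joined to the column `N` by an
`ω`-open path of `A_{m,N}` is joined by an `ω`-open path of `A_{m,N}` to a site joined to the column
`-N` by an `ω`-open path of `A_{m,N}`. [cite: KestenPTM1982, §2.2–2.3] [cite: Nolin2008, §4.1 (arm events and clusters)] -/
theorem not_openConnIn_sqAnnulus_of_outDualArms (hm : 1 ≤ m) (hmN : m ≤ N)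
    {ω : BondConfig (Site 2)} (hω : ω ⊆ (zdGraph 2).edgeSet)
    {xR zR xL zL : Site 2} (R : (zdGraph 2).Walk xR zR) (hRs : ∀ v ∈ R.support, v ∈ sqAnnulus m N)
    (hRo : ∀ e ∈ R.edges, e ∈ ω) (hzR : zR 0 = N)
    (L : (zdGraph 2).Walk xL zL) (hLs : ∀ v ∈ L.support, v ∈ sqAnnulus m N)
    (hLo : ∀ e ∈ L.edges, e ∈ ω) (hzL : zL 0 = -(N : ℤ))
    {fT gT : Site 2} (QT : (zdGraph 2).Walk fT gT)
    (hfT : -(m : ℤ) ≤ fT 0 ∧ fT 0 + 1 ≤ m ∧ -(m : ℤ) ≤ fT 1 ∧ fT 1 + 1 ≤ m) (hgT : gT 1 = N)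
    (hQTc : ∀ d ∈ QT.darts, sepEdge d.fst d.snd ∉ ω)
    (hQTa : ∀ d ∈ QT.darts, ∀ v ∈ sepEdge d.fst d.snd, v ∈ sqAnnulus m N)
    {fB gB : Site 2} (QB : (zdGraph 2).Walk fB gB)
    (hfB : -(m : ℤ) ≤ fB 0 ∧ fB 0 + 1 ≤ m ∧ -(m : ℤ) ≤ fB 1 ∧ fB 1 + 1 ≤ m) (hgB : gB 1 + 1 = -(N : ℤ))
    (hQBc : ∀ d ∈ QB.darts, sepEdge d.fst d.snd ∉ ω)
    (hQBa : ∀ d ∈ QB.darts, ∀ v ∈ sepEdge d.fst d.snd, v ∈ sqAnnulus m N) :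
    ω ∉ openConnIn (sqAnnulus m N) xR xL := by
  intro h
  obtain ⟨Pc, hPcs, hPce⟩ := exists_walk_of_mem_openConnIn hω h
  set W : (zdGraph 2).Walk zL zR := L.reverse.append (Pc.reverse.append R) with hW
  have hWs : ∀ v ∈ W.support, v ∈ sqAnnulus m N := by
    intro v hv
    rw [hW, Walk.mem_support_append_iff, Walk.support_reverse, List.mem_reverse,
      Walk.mem_support_append_iff, Walk.support_reverse, List.mem_reverse] at hv
    rcases hv with hv | hv | hv
    · exact hLs v hv
    · exact hPcs v hv
    · exact hRs v hv
  have hWo : ∀ e ∈ W.edges, e ∈ ω := by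
    intro e he
    rw [hW, Walk.edges_append, List.mem_append, Walk.edges_reverse, List.mem_reverse, Walk.edges_append,
      List.mem_append, Walk.edges_reverse, List.mem_reverse] at he
    rcases he with he | he | he
    · exact hLo e he
    · exact hPce e he
    · exact hRo e he
  rcases sqAnnulus_outDualArms_cross hm hmN W hWs hzL hzR QT hfT hgT hQTa QB hfB hgB hQBa with
    ⟨d, hd, he⟩ | ⟨d, hd, he⟩
  · exact hQTc d hd (hWo _ he)
  · exact hQBc d hd (hWo _ he)

/-- **`zdFourArmOutLanded m N ⊆ fourArmTwoClusters m N` on lattice configurations** (`1 ≤ m ≤ N`):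
the two open bodies are open crossings of `A_{m,N}` from the sphere `‖·‖_∞ = m` to `(±N, ·)`, and
their inner ends are not joined by an open path of the annulus because of the two closed dual
bodies (`not_openConnIn_sqAnnulus_of_outDualArms`). [cite: Nolin2008, §4.1 (arm events and clusters) and §4.4] [cite: KestenPTM1982, §2.2–2.3] -/
theorem mem_fourArmTwoClusters_of_mem_zdFourArmOutLanded (hm : 1 ≤ m) (hmN : m ≤ N)
    {ω : BondConfig (Site 2)} (hω : ω ⊆ (zdGraph 2).edgeSet) (h : ω ∈ zdFourArmOutLanded m N) :
    ω ∈ fourArmTwoClusters m N := by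
  obtain ⟨⟨⟨A⟩, ⟨B⟩⟩, ⟨⟨T⟩, ⟨D⟩⟩⟩ := h
  have hzA := A.hz
  have hzB := B.hz
  have hN1 : 1 ≤ N := hm.trans hmN
  have hdN : ((N / 64 : ℕ) : ℤ) ≤ N := by exact_mod_cast Nat.div_le_self N 64
  refine ⟨A.x, A.hx, B.x, B.hx,
    A.z, mem_siteSphere_of_apply_zero hN1 (Or.inl hzA.1) (abs_le.2 ⟨by omega, by omega⟩),
    B.z, mem_siteSphere_of_apply_zero hN1 (Or.inr hzB.1) (abs_le.2 ⟨by omega, by omega⟩),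
    mem_openConnIn_of_walk A.W A.hW A.hWo, mem_openConnIn_of_walk B.W B.hW B.hWo, ?_⟩
  exact not_openConnIn_sqAnnulus_of_outDualArms hm hmN hω A.W A.hW A.hWo hzA.1 B.W B.hW B.hWo hzB.1
    T.Q T.hf T.hg.1 T.hQc T.hQa D.Q D.hf D.hg.1 D.hQc D.hQa

/-- **`P_p(zdFourArmOutLanded m N) ≤ P_p(fourArmTwoClusters m N)`** for `1 ≤ m ≤ N` and every `p`
(lattice configurations carry `P_p`). [cite: Nolin2008, §4.1 and §4.4 (the events Ã are sub-events of A)] -/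
theorem real_zdFourArmOutLanded_le_fourArmTwoClusters (p : unitInterval) (hm : 1 ≤ m) (hmN : m ≤ N) :
    (bondPercolation (zdGraph 2) p).real (zdFourArmOutLanded m N) ≤
      (bondPercolation (zdGraph 2) p).real (fourArmTwoClusters m N) := by
  refine ENNReal.toReal_mono (MeasureTheory.measure_ne_top _ _) (MeasureTheory.measure_mono_ae ?_)
  have hae : ∀ᵐ ω ∂(bondPercolation (zdGraph 2) p), ω ⊆ (zdGraph 2).edgeSet :=
    ProbabilityTheory.setBernoulli_ae_subset
  filter_upwards [hae] with ω hω h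
  exact mem_fourArmTwoClusters_of_mem_zdFourArmOutLanded hm hmN hω h

/-- **The two open bodies of an outer-landed configuration are vertex-disjoint** (lattice
configurations, `1 ≤ m ≤ N`): a common vertex would join the inner end of the right body to the
inner end of the left body inside the annulus. [cite: Nolin2008, §4.1 (arm events and clusters)] -/
theorem disjoint_support_of_mem_zdFourArmOutLanded (hm : 1 ≤ m) (hmN : m ≤ N)
    {ω : BondConfig (Site 2)} (hω : ω ⊆ (zdGraph 2).edgeSet) {lo' hi' lo'' hi'' l₃ h₃ l₄ h₄ : ℤ}
    (A : ZdOutOpenArmR ω m N lo' hi') (B : ZdOutOpenArmL ω m N lo'' hi'')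
    (T : ZdOutDualArmT ω m N l₃ h₃) (D : ZdOutDualArmB ω m N l₄ h₄) :
    ∀ v ∈ A.W.support, v ∉ B.W.support := by
  intro v hvA hvB
  have h1 : ω ∈ openConnIn (sqAnnulus m N) A.x v := mem_openConnIn_of_mem_support A.W A.hW A.hWo hvA
  have h2 : ω ∈ openConnIn (sqAnnulus m N) B.x v := mem_openConnIn_of_mem_support B.W B.hW B.hWo hvB
  rw [openConnIn_comm] at h2
  exact not_openConnIn_sqAnnulus_of_outDualArms hm hmN hω A.W A.hW A.hWo A.hz.1 B.W B.hW B.hWo B.hz.1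
    T.Q T.hf T.hg.1 T.hQc T.hQa D.Q D.hf D.hg.1 D.hQc D.hQa (PlanarDuality.openConnIn_trans h1 h2)

end Barrier

end Literature.Probability.Percolation

end
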